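import Mathlib
import Summits.AnomalousDissipation.AnomalousDissipation.Theses.DyadicWallCascade
import Summits.AnomalousDissipation.AnomalousDissipation.Theorems.DyadicWallCascadeDyadicRealisationFluxSign
import Summits.AnomalousDissipation.AnomalousDissipation.Theorems.DyadicWallCascadeDyadicRealisationZeroStress
import HarnessLib

/-!
# Route `DyadicWallCascade`, crux `DyadicRealisation` (stmt-AnomalousDissipation-17918), line `Sketch`:
# the forced normalisations of a viscous wall profile

Corollaries of the landed stubs `stub_fluxSign` (p152335) and `stub_zeroStress` (p154515):

* `not_profile_of_flux_pos` — the OUTFLOW variant of the antecedent `ViscousWallProfile` (clause `0 < F`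
  in place of `F ≠ 0`) is empty: inflow profiles only.  (Verbatim the disprover's sorried near-miss of
  `Cruxes/DyadicRealisation/Disproof.lean` §5, now closed.)
* `not_profile_of_stress_ne_zero` — the SHEARED variant (an extra clause `τ₀ ≠ 0 ∨ τ₁ ≠ 0`, non-zero
  Reynolds stress of the blow-down through the unit square of `z = 1`) is empty.  (Ditto.)
* `stub_profileNormalisations` (registered stub; the planner sketch's `ProfileNormalisations`) — a
  viscous wall profile yields a half-space hierarchy `(V, Q, C, F)` that is NORMALISED: `F < 0` and
  `τ₀ = τ₁ = 0`.  These are exactly the two facts about `W` that line `Sketch` consumes; the route header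
  lists them as the forced normalisations of the rev-2 profile object.
-/

noncomputable section

open MeasureTheory Filter Set
open scoped InnerProductSpace Topology BigOperators

-- the mandated namespace `Summit.<Summit>.<Problem>.Theorems` repeats `AnomalousDissipation`
set_option linter.dupNamespace false

namespace Summit.AnomalousDissipation.AnomalousDissipation.Theorems

/-- **Inflow only: the outflow variant of the viscous-wall-profile block is empty.**  If `(W, P, V, Q, C,
F, C')` satisfied the clauses of `DyadicWallCascade.ViscousWallProfile` with `0 < F` in place of `F ≠ 0`,
then `stub_fluxSign` (localised energy identity + blow-down scaling) would give `F < 0`. [folklore] -/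
theorem not_profile_of_flux_pos :
    ¬ ∃ (W : EuclideanSpace ℝ (Fin 3) → EuclideanSpace ℝ (Fin 3)) (P : EuclideanSpace ℝ (Fin 3) →
    ℝ) (V : EuclideanSpace ℝ (Fin 3) → EuclideanSpace ℝ (Fin 3)) (Q : EuclideanSpace ℝ (Fin 3) → ℝ)
    (C F C' : ℝ),
      let H : Set (EuclideanSpace ℝ (Fin 3)) := {X | 0 < X 2};
      let e : Fin 3 → EuclideanSpace ℝ (Fin 3) := fun i => EuclideanSpace.single i (1 : ℝ);
      let pt : ℝ × ℝ → EuclideanSpace ℝ (Fin 3) := fun q => !₂[q.1, q.2, (1 : ℝ)];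
      let σ : EuclideanSpace ℝ (Fin 3) → EuclideanSpace ℝ (Fin 3) := fun X => X - (2 * X 2) • e 2;
      (ContDiffOn ℝ ((⊤ : ℕ∞) : WithTop ℕ∞) V H ∧ ContDiffOn ℝ ((⊤ : ℕ∞) : WithTop ℕ∞) Q H ∧ (∀ X ∈
      H, ‖V X‖ ≤ C ∧ |Q X| ≤ C) ∧ (∀ X ∈ H, ∑ i : Fin 3, (fderiv ℝ V X (e i)) i = 0) ∧ (∀ X ∈ H,
      (fderiv ℝ V X) (V X) + gradient Q X = 0) ∧ (∀ X ∈ H, V ((2 : ℝ) • X) = V X ∧ Q ((2 : ℝ) • X)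
      = Q X) ∧ (∀ X : EuclideanSpace ℝ (Fin 3), 1 ≤ X 2 → X 2 ≤ 2 → V (X + e 0) = V X ∧ V (X + e 1)
      = V X ∧ Q (X + e 0) = Q X ∧ Q (X + e 1) = Q X) ∧ (∫ q in Set.Icc (0 : ℝ) 1 ×ˢ Set.Icc (0 : ℝ)
      1, (V (pt q)) 2 = 0) ∧ 0 < F ∧ (∫ q in Set.Icc (0 : ℝ) 1 ×ˢ Set.Icc (0 : ℝ) 1, (V (pt q)) 2 *
      (‖V (pt q)‖ ^ 2 / 2 + Q (pt q)) = F)) ∧ ContDiff ℝ ((⊤ : ℕ∞) : WithTop ℕ∞) W ∧ ContDiff ℝ ((⊤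
      : ℕ∞) : WithTop ℕ∞) P ∧ (∀ X, ‖W X‖ ≤ C' ∧ |P X| ≤ C') ∧ (∀ X, W (σ X) = σ (W X) ∧ P (σ X) =
      P X) ∧ (∀ X, ∑ i : Fin 3, (fderiv ℝ W X (e i)) i = 0) ∧ (∀ X, (fderiv ℝ W X) (W X) + gradient
      P X = ∑ i : Fin 3, fderiv ℝ (fun Y => fderiv ℝ W Y (e i)) X (e i)) ∧ (∀ ε : ℝ, 0 < ε → ∃ M :
      ℕ, ∀ m : ℕ, M ≤ m → ∀ X : EuclideanSpace ℝ (Fin 3), 1 ≤ X 2 → X 2 ≤ 2 → ‖W ((2 : ℝ) ^ m • X)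
      - V X‖ ≤ ε ∧ |P ((2 : ℝ) ^ m • X) - Q X| ≤ ε) := by
  rintro ⟨W, P, V, Q, C, F, C', ⟨h1, h2, h3, h4, h5, h6, h7, h8, hFpos, h10⟩, hrest⟩
  have key : F < 0 :=
    stub_fluxSign W P V Q C F C' ⟨⟨h1, h2, h3, h4, h5, h6, h7, h8, hFpos.ne', h10⟩, hrest⟩
  exact lt_irrefl _ (hFpos.trans key)

/-- **Zero Reynolds stress: the sheared variant of the viscous-wall-profile block is empty.**  If the
clauses of `DyadicWallCascade.ViscousWallProfile` held together with a non-zero Reynolds stress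
`∫_{[0,1]²} V₂V₀(q,1) dq ≠ 0` or `∫_{[0,1]²} V₂V₁(q,1) dq ≠ 0` of the blow-down, `stub_zeroStress` (localised
horizontal momentum identity + blow-down scaling) would be contradicted. [folklore] -/
theorem not_profile_of_stress_ne_zero :
    ¬ ∃ (W : EuclideanSpace ℝ (Fin 3) → EuclideanSpace ℝ (Fin 3)) (P : EuclideanSpace ℝ (Fin 3) →
    ℝ) (V : EuclideanSpace ℝ (Fin 3) → EuclideanSpace ℝ (Fin 3)) (Q : EuclideanSpace ℝ (Fin 3) → ℝ)
    (C F C' : ℝ),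
      let H : Set (EuclideanSpace ℝ (Fin 3)) := {X | 0 < X 2};
      let e : Fin 3 → EuclideanSpace ℝ (Fin 3) := fun i => EuclideanSpace.single i (1 : ℝ);
      let pt : ℝ × ℝ → EuclideanSpace ℝ (Fin 3) := fun q => !₂[q.1, q.2, (1 : ℝ)];
      let σ : EuclideanSpace ℝ (Fin 3) → EuclideanSpace ℝ (Fin 3) := fun X => X - (2 * X 2) • e 2;
      (ContDiffOn ℝ ((⊤ : ℕ∞) : WithTop ℕ∞) V H ∧ ContDiffOn ℝ ((⊤ : ℕ∞) : WithTop ℕ∞) Q H ∧ (∀ X ∈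
      H, ‖V X‖ ≤ C ∧ |Q X| ≤ C) ∧ (∀ X ∈ H, ∑ i : Fin 3, (fderiv ℝ V X (e i)) i = 0) ∧ (∀ X ∈ H,
      (fderiv ℝ V X) (V X) + gradient Q X = 0) ∧ (∀ X ∈ H, V ((2 : ℝ) • X) = V X ∧ Q ((2 : ℝ) • X)
      = Q X) ∧ (∀ X : EuclideanSpace ℝ (Fin 3), 1 ≤ X 2 → X 2 ≤ 2 → V (X + e 0) = V X ∧ V (X + e 1)
      = V X ∧ Q (X + e 0) = Q X ∧ Q (X + e 1) = Q X) ∧ (∫ q in Set.Icc (0 : ℝ) 1 ×ˢ Set.Icc (0 : ℝ)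
      1, (V (pt q)) 2 = 0) ∧ F ≠ 0 ∧ (∫ q in Set.Icc (0 : ℝ) 1 ×ˢ Set.Icc (0 : ℝ) 1, (V (pt q)) 2 *
      (‖V (pt q)‖ ^ 2 / 2 + Q (pt q)) = F)) ∧ ContDiff ℝ ((⊤ : ℕ∞) : WithTop ℕ∞) W ∧ ContDiff ℝ ((⊤
      : ℕ∞) : WithTop ℕ∞) P ∧ (∀ X, ‖W X‖ ≤ C' ∧ |P X| ≤ C') ∧ (∀ X, W (σ X) = σ (W X) ∧ P (σ X) =
      P X) ∧ (∀ X, ∑ i : Fin 3, (fderiv ℝ W X (e i)) i = 0) ∧ (∀ X, (fderiv ℝ W X) (W X) + gradient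
      P X = ∑ i : Fin 3, fderiv ℝ (fun Y => fderiv ℝ W Y (e i)) X (e i)) ∧ (∀ ε : ℝ, 0 < ε → ∃ M :
      ℕ, ∀ m : ℕ, M ≤ m → ∀ X : EuclideanSpace ℝ (Fin 3), 1 ≤ X 2 → X 2 ≤ 2 → ‖W ((2 : ℝ) ^ m • X)
      - V X‖ ≤ ε ∧ |P ((2 : ℝ) ^ m • X) - Q X| ≤ ε) ∧ ((∫ q in Set.Icc (0 : ℝ) 1 ×ˢ Set.Icc (0 : ℝ)
      1, (V (pt q)) 2 * (V (pt q)) 0 ≠ 0) ∨ (∫ q in Set.Icc (0 : ℝ) 1 ×ˢ Set.Icc (0 : ℝ) 1, (V (pt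
      q)) 2 * (V (pt q)) 1 ≠ 0)) := by
  rintro ⟨W, P, V, Q, C, F, C', hV, hW, hP, hbd, hmir, hdiv, hNS, hblow, hdisj⟩
  obtain ⟨hτ0, hτ1⟩ := stub_zeroStress W P V Q C F C' ⟨hV, hW, hP, hbd, hmir, hdiv, hNS, hblow⟩
  rcases hdisj with h | h
  · exact h hτ0
  · exact h hτ1

/-- **stub_profileNormalisations** (the planner sketch's `ProfileNormalisations`, registered on the crux
item): a viscous wall profile yields a NORMALISED half-space hierarchy — the hierarchy clauses of its
blow-down `(V, Q, C, F)` together with `F < 0` (`stub_fluxSign`) and zero Reynolds stress `τ₀ = τ₁ = 0`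
(`stub_zeroStress`). [folklore] -/
theorem stub_profileNormalisations : Summit.AnomalousDissipation.AnomalousDissipation.Theses.DyadicWallCascade.ViscousWallProfile → ∃ (V : EuclideanSpace ℝ (Fin 3) → EuclideanSpace ℝ (Fin 3)) (Q : EuclideanSpace ℝ (Fin 3) → ℝ) (C F : ℝ), (ContDiffOn ℝ ((⊤ : ℕ∞) : WithTop ℕ∞) V {X : EuclideanSpace ℝ (Fin 3) | 0 < X 2} ∧ ContDiffOn ℝ ((⊤ : ℕ∞) : WithTop ℕ∞) Q {X : EuclideanSpace ℝ (Fin 3) | 0 < X 2} ∧ (∀ X : EuclideanSpace ℝ (Fin 3), 0 < X 2 → ‖V X‖ ≤ C ∧ |Q X| ≤ C) ∧ (∀ X : EuclideanSpace ℝ (Fin 3), 0 < X 2 → ∑ i : Fin 3, (fderiv ℝ V X (EuclideanSpace.single i (1 : ℝ))) i = 0) ∧ (∀ X : EuclideanSpace ℝ (Fin 3), 0 < X 2 → (fderiv ℝ V X) (V X) + gradient Q X = 0) ∧ (∀ X : EuclideanSpace ℝ (Fin 3), 0 < X 2 → V ((2 : ℝ) • X) = V X ∧ Q ((2 : ℝ)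 • X) = Q X) ∧ (∀ X : EuclideanSpace ℝ (Fin 3), 1 ≤ X 2 → X 2 ≤ 2 → V (X + EuclideanSpace.single 0 (1 : ℝ)) = V X ∧ V (X + EuclideanSpace.single 1 (1 : ℝ)) = V X ∧ Q (X + EuclideanSpace.single 0 (1 : ℝ)) = Q X ∧ Q (X + EuclideanSpace.single 1 (1 : ℝ)) = Q X) ∧ (∫ q in Set.Icc (0 : ℝ) 1 ×ˢ Set.Icc (0 : ℝ) 1, (V !₂[q.1, q.2, (1 : ℝ)]) 2 = 0) ∧ F ≠ 0 ∧ (∫ q in Set.Icc (0 : ℝ) 1 ×ˢ Set.Icc (0 : ℝ) 1, (V !₂[q.1, q.2, (1 : ℝ)]) 2 * (‖V !₂[q.1, q.2, (1 : ℝ)]‖ ^ 2 / 2 + Q !₂[q.1, q.2, (1 : ℝ)]) = F)) ∧ F < 0 ∧ (∫ q in Set.Icc (0 : ℝ) 1 ×ˢ Set.Icc (0 : ℝ) 1, (V !₂[q.1, q.2, (1 : ℝ)]) 2 * (V !₂[q.1, q.2, (1 : ℝ)]) 0 = 0) ∧ (∫ q in Set.Icc (0 : ℝ) 1 ×ˢ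 Set.Icc (0 : ℝ) 1, (V !₂[q.1, q.2, (1 : ℝ)]) 2 * (V !₂[q.1, q.2, (1 : ℝ)]) 1 = 0) := by
  rintro ⟨W, P, V, Q, C, F, C', hblk⟩
  have hF : F < 0 := stub_fluxSign W P V Q C F C' hblk
  have hτ := stub_zeroStress W P V Q C F C' hblk
  exact ⟨V, Q, C, F, hblk.1, hF, hτ.1, hτ.2⟩

end Summit.AnomalousDissipation.AnomalousDissipation.Theorems

end
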